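import Literature.AlgebraicGeometry.PlaneCurves.HessePencilTriangles
import HarnessLib

/-!
# The invariant sextic `Φ₆`, the 8-cuspidal sextic `Φ₆′`, and the syzygy of the Hessian
# invariants (Artebani–Dolgachev §6)

Topic `Literature/AlgebraicGeometry/PlaneCurves`, namespace `Literature.AlgebraicGeometry.PlaneCurves`.
Lane `lit-hodgefound`, seat `lit-hodgefound-p37`, row g19-#4; a one-file sequel of
`HessePencilInvariants` (g18-#6: `Φ₆, Φ₉, Φ₁₂, Φ'₁₂, Φ₁₈`), `HessePencilEightCubics` (g19-#3: the
Halphen cubics `B₁, …, B₈`) and `HessePencilShortWeierstrassForm` (g19-#2: the binary forms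
`A(u₀,u₁) = 12u₁(u₀³ − u₁³)`, `B(u₀,u₁) = 2(u₀⁶ − 20u₀³u₁³ − 8u₁⁶)`).  Everything here is PROVED
(polynomial identities and evaluations); no definition, no named fact.

Source followed — M. Artebani, I. Dolgachev, *The Hesse pencil of plane cubic curves*,
L'Enseignement Math. (2) 55 (2009) 235–273, §6 "The 8-cuspidal sextic" [arXiv:math/0611590, held
`paper:arxiv-math_0611590` p0012 L1–L60, p0013 L1–L10], VERBATIM:

> Let `C₆` be the sextic curve with equation `Φ₆ = 0`, where `Φ₆` is the degree six invariant of
> the Hessian group. This is a smooth curve and it is immediately checked that it does not contain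
> the vertices of the inflection triangles `T₁, …, T₄` given in (vertices) as well as the base
> points of the Hesse pencil. […] Observe that the curve `C₆` is tangent to each Halphen cubic
> `Bᵢ, Bᵢ′` at a `Γ`-orbit of `9` points. In fact, it is enough to check that `C₆` is tangent to
> one of them, say `B₁`, at some point. We have
> `x⁶ + y⁶ + z⁶ − 10(x³y³ + x³z³ + y³z³) = (x³ + y³ + z³)² − 12(x³y³ + x³z³ + y³z³)`
> `= −3(x³ + y³ + z³)² + 4(x³ + εy³ + ε²z³)(x³ + ε²y³ + εz³)`.
> This shows that the curves `B₁` and `B₁′` are tangent to `C₆` at the points where `C₆`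
> intersects the curve `E₀ : x³ + y³ + z³ = 0`. […]
> **Proposition 6.1.** The 8-cuspidal sextic `C₆′` is projectively equivalent to the sextic curve
> defined by the polynomial
> `Φ₆′(x, y, z) = (x³ + y³ + z³)² − 36y³z³ + 24(z⁴y² + z²y⁴) − 12(z⁵y + zy⁵) − 12x³(z²y + zy²)`.
> *Proof.* […] we may assume that the sextic has cusps at `p₁, …, p₈`. Let `V` be the vector space
> of homogeneous polynomials of degree `6` vanishing at `p₁, …, p₈` with multiplicity `≥ 2`. […]
> **Remark 6.2.** […] The surface `S` is a Del Pezzo surface of degree `1` and admits a birational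
> morphism `ψ : S → S̄` onto a surface in the weighted projective space `ℙ(1, 1, 2, 3)` given by an
> equation `−u₃² + u₂³ + A(u₀, u₁)u₂ + B(u₀, u₁) = 0` […] Up to some constant factors, the
> polynomials `A, B` are the same as in (binary). […] This agrees with a remark of van Geemen in
> [vG] that the polynomials `xyz, x³ + y³ + z³, Φ₆(x, y, z)`, and `Φ₉(x, y, z)` satisfy the same
> relation (relation) as the polynomials `xyz, x³ + y³ + z³, Φ₆′(x, y, z)`, and `P₉(x, y, z)`.

## What is here (`K` a field; `ω² + ω + 1 = 0` where `ε` occurs)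

* §1 `phi6_eq_sq_sub` — `Φ₆ = (x³+y³+z³)² − 12(x³y³+x³z³+y³z³)`; **`phi6_eq_B₁_mul_B₅`** —
  `Φ₆ = −3(x³+y³+z³)² + 4B₁B₁′`, `B₁ = x³ + εy³ + ε²z³`, `B₁′ = B₅ = x³ + ε²y³ + εz³`; hence
  `phi6_inter_fermat_subset` (a point of `C₆ ∩ E₀` lies on `B₁ ∪ B₁′`) and
  **`phi6_grad_of_mem`** (at a point of `E₀ ∩ B₁`: `∇Φ₆ = 4B₁′·∇B₁` — "the curves `B₁` and `B₁′`
  are tangent to `C₆` at the points where `C₆` intersects `E₀`").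
* §2 **The syzygy** (Remark 6.2 / van Geemen, constants pinned here; any commutative ring):
  `hessian_invariants_syzygy` —
  `432·Φ₉² = Φ₆³ − 3t⁴Φ₆ + 2t⁶ − 1080t³s³ − 648ts³Φ₆ − 11664s⁶` (`t = x³+y³+z³`, `s = xyz`;
  the discriminant of the cubic with roots `x³, y³, z³`), and `hessian_invariants_syzygy_weighted`
  — **`−u₃² + u₂³ + A(u₀,u₁)u₂ + B(u₀,u₁) = 0` with `(u₀, u₁, u₂, u₃²) = (−6xyz, x³+y³+z³, −2Φ₆,
  −3456Φ₉²)`**, i.e. `xyz, x³+y³+z³, Φ₆, Φ₉` satisfy the relation (relation) "up to some constant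
  factors" (`u₃ = 24√−6·Φ₉`).
* §3 **Proposition 6.1's polynomial has double points at `p₁, …, p₈`**: `phi6'_double_points` —
  `Φ₆′(pᵢ) = 0` and `∇Φ₆′(pᵢ) = 0` for the eight base points `pᵢ ≠ p₀` ("vanishing at `p₁, …, p₈`
  with multiplicity `≥ 2`"), `phi6'_eval_p₀` — `Φ₆′(p₀) = 108`, `∇Φ₆′(p₀) = (0, 324, −324)`
  (`p₀ ∉ C₆′` when `2, 3 ≠ 0`), and `phi6'_tangentCone_p₃` — at `p₃ = (1, 0, −1)` the second
  derivatives are `18·(1, −2, 1)ᵀ(1, −2, 1)`: the tangent cone is the double line `(x − 2y + z)²`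
  (a cusp, not a node).
* §4 **"it does not contain the vertices … as well as the base points"**: `phi6_eval_vertices` —
  `Φ₆ = 1` at `(1,0,0), (0,1,0), (0,0,1)`, `Φ₆ = −27` at the nine other vertices, `Φ₆ = 12` at the
  nine base points (so `C₆` avoids all `21` points when `2, 3 ≠ 0`, `phi6_ne_zero_vertices`); and
  **"This is a smooth curve"**: `phi6_smooth` — for `2, 3 ≠ 0`, `Φ₆(p) = 0 ∧ ∇Φ₆(p) = 0 ⇒ p = 0`.

NOT here: that the double points of `Φ₆′` are ordinary cusps `A₂` beyond the tangent-cone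
statement at `p₃`, the projective equivalence `C₆′ ≅ C₆/Γ` itself (Prop. 6.1 proper: the
`SL(2, 𝔽₃)`-representation argument), `P₉`, Prop. 6.3 (MAPLE), the surfaces of Remark 6.2.

## References
* [ArtebaniDolgachev2009] M. Artebani, I. Dolgachev, *The Hesse pencil of plane cubic curves*,
  Enseign. Math. (2) 55 (2009) 235–273, §6 (the sextics `C₆`, `C₆′`, Prop. 6.1, Remark 6.2).
-/

set_option autoImplicit false

open MvPolynomial Matrix

namespace Literature.AlgebraicGeometry.PlaneCurves

universe u

/-- `Φ₆ = x⁶ + y⁶ + z⁶ − 10(x³y³ + x³z³ + y³z³)` (local notation as in `HessePencilInvariants`). -/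
local notation3 "Φ₆" => (X 0 ^ 6 + X 1 ^ 6 + X 2 ^ 6 -
  10 * (X 0 ^ 3 * X 1 ^ 3 + X 0 ^ 3 * X 2 ^ 3 + X 1 ^ 3 * X 2 ^ 3) : MvPolynomial (Fin 3) _)

/-- `Φ₉ = (x³ − y³)(x³ − z³)(y³ − z³)` (local notation as in `HessePencilInvariants`). -/
local notation3 "Φ₉" =>
  ((X 0 ^ 3 - X 1 ^ 3) * (X 0 ^ 3 - X 2 ^ 3) * (X 1 ^ 3 - X 2 ^ 3) : MvPolynomial (Fin 3) _)

/-- Artebani–Dolgachev's `Φ₆′ = (x³+y³+z³)² − 36y³z³ + 24(z⁴y² + z²y⁴) − 12(z⁵y + zy⁵) − 12x³(z²y + zy²)`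
(Prop. 6.1; local notation, no definition). -/
local notation3 "Φ₆'" => ((X 0 ^ 3 + X 1 ^ 3 + X 2 ^ 3) ^ 2 - 36 * (X 1 ^ 3 * X 2 ^ 3) +
  24 * (X 2 ^ 4 * X 1 ^ 2 + X 2 ^ 2 * X 1 ^ 4) - 12 * (X 2 ^ 5 * X 1 + X 2 * X 1 ^ 5) -
  12 * X 0 ^ 3 * (X 2 ^ 2 * X 1 + X 2 * X 1 ^ 2) : MvPolynomial (Fin 3) _)

/-- `B₁ = x³ + εy³ + ε²z³` (local notation as in `HessePencilEightCubics`). -/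
local notation3 "𝐁₁[" ω "]" => (X 0 ^ 3 + C ω * X 1 ^ 3 + C (ω ^ 2) * X 2 ^ 3 : MvPolynomial (Fin 3) _)

/-- `B₁′ = B₅ = x³ + ε²y³ + εz³` (local notation). -/
local notation3 "𝐁₅[" ω "]" => (X 0 ^ 3 + C (ω ^ 2) * X 1 ^ 3 + C ω * X 2 ^ 3 : MvPolynomial (Fin 3) _)

section CuspidalSextic

variable {K : Type u} [Field K]

/-! ## §0 Plumbing -/

/-- Derivations kill numerals (`no_index` so that `simp` matches literals). [folklore] -/
private theorem pderiv_ofNat_c (i : Fin 3) (n : ℕ) [n.AtLeastTwo] :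
    pderiv i (no_index (OfNat.ofNat n : MvPolynomial (Fin 3) K)) = 0 := by
  rw [← map_ofNat (C : K →+* MvPolynomial (Fin 3) K) n, pderiv_C]

omit [Field K] in
/-- `![a, b, c] = ![a′, b′, c′]` componentwise. [folklore] -/
private theorem vec3_eq_iff' (a b c a' b' c' : K) :
    (![a, b, c] : Fin 3 → K) = ![a', b', c'] ↔ a = a' ∧ b = b' ∧ c = c' := by
  constructor
  · intro h
    exact ⟨by simpa using congr_fun h 0, by simpa using congr_fun h 1, by simpa using congr_fun h 2⟩
  · rintro ⟨rfl, rfl, rfl⟩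
    rfl

/-- `![a, b, c] = 0` componentwise. [folklore] -/
private theorem vec3_eq_zero_iff (a b c : K) :
    (![a, b, c] : Fin 3 → K) = 0 ↔ a = 0 ∧ b = 0 ∧ c = 0 := by
  rw [show (0 : Fin 3 → K) = ![0, 0, 0] by ext i; fin_cases i <;> simp, vec3_eq_iff']

/-- `Φ₆(p)` written out. [folklore] -/
private theorem phi6_eval (p : Fin 3 → K) :
    eval p (Φ₆ : MvPolynomial (Fin 3) K) =
      p 0 ^ 6 + p 1 ^ 6 + p 2 ^ 6 - 10 * (p 0 ^ 3 * p 1 ^ 3 + p 0 ^ 3 * p 2 ^ 3 + p 1 ^ 3 * p 2 ^ 3) := by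
  simp

/-- `∇Φ₆(p) = (6p₀⁵ − 30p₀²(p₁³ + p₂³), …)`. [folklore] -/
private theorem phi6_eval_pderiv (p : Fin 3 → K) :
    (fun i => eval p (pderiv i (Φ₆ : MvPolynomial (Fin 3) K))) =
      ![6 * p 0 ^ 5 - 30 * p 0 ^ 2 * p 1 ^ 3 - 30 * p 0 ^ 2 * p 2 ^ 3,
        -30 * p 0 ^ 3 * p 1 ^ 2 + 6 * p 1 ^ 5 - 30 * p 1 ^ 2 * p 2 ^ 3,
        -30 * p 0 ^ 3 * p 2 ^ 2 - 30 * p 1 ^ 3 * p 2 ^ 2 + 6 * p 2 ^ 5] := by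
  funext i
  fin_cases i <;> simp [pderiv_X, pderiv_ofNat_c, map_ofNat] <;> ring

/-- `Φ₆′(p)` written out. [folklore] -/
private theorem phi6'_eval (p : Fin 3 → K) :
    eval p (Φ₆' : MvPolynomial (Fin 3) K) =
      p 0 ^ 6 + 2 * p 0 ^ 3 * p 1 ^ 3 - 12 * p 0 ^ 3 * p 1 ^ 2 * p 2 - 12 * p 0 ^ 3 * p 1 * p 2 ^ 2 +
        2 * p 0 ^ 3 * p 2 ^ 3 + p 1 ^ 6 - 12 * p 1 ^ 5 * p 2 + 24 * p 1 ^ 4 * p 2 ^ 2 -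
        34 * p 1 ^ 3 * p 2 ^ 3 + 24 * p 1 ^ 2 * p 2 ^ 4 - 12 * p 1 * p 2 ^ 5 + p 2 ^ 6 := by
  simp
  ring

/-- `∇Φ₆′(p)` written out. [folklore] -/
private theorem phi6'_eval_pderiv (p : Fin 3 → K) :
    (fun i => eval p (pderiv i (Φ₆' : MvPolynomial (Fin 3) K))) =
      ![6 * p 0 ^ 5 + 6 * p 0 ^ 2 * p 1 ^ 3 - 36 * p 0 ^ 2 * p 1 ^ 2 * p 2 -
          36 * p 0 ^ 2 * p 1 * p 2 ^ 2 + 6 * p 0 ^ 2 * p 2 ^ 3,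
        6 * p 0 ^ 3 * p 1 ^ 2 - 24 * p 0 ^ 3 * p 1 * p 2 - 12 * p 0 ^ 3 * p 2 ^ 2 + 6 * p 1 ^ 5 -
          60 * p 1 ^ 4 * p 2 + 96 * p 1 ^ 3 * p 2 ^ 2 - 102 * p 1 ^ 2 * p 2 ^ 3 + 48 * p 1 * p 2 ^ 4 -
          12 * p 2 ^ 5,
        -12 * p 0 ^ 3 * p 1 ^ 2 - 24 * p 0 ^ 3 * p 1 * p 2 + 6 * p 0 ^ 3 * p 2 ^ 2 - 12 * p 1 ^ 5 +
          48 * p 1 ^ 4 * p 2 - 102 * p 1 ^ 3 * p 2 ^ 2 + 96 * p 1 ^ 2 * p 2 ^ 3 - 60 * p 1 * p 2 ^ 4 +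
          6 * p 2 ^ 5] := by
  funext i
  fin_cases i <;> simp [pderiv_X, pderiv_ofNat_c, map_ofNat] <;> ring

/-! ## §1 `Φ₆ = t² − 12e = −3t² + 4B₁B₁′`: the tangency of `C₆` with the Halphen cubics -/

/-- **`x⁶ + y⁶ + z⁶ − 10(x³y³ + x³z³ + y³z³) = (x³ + y³ + z³)² − 12(x³y³ + x³z³ + y³z³)`**
(any field). [cite: ArtebaniDolgachev2009, §6 (first display)] -/
theorem phi6_eq_sq_sub :
    (Φ₆ : MvPolynomial (Fin 3) K) =
      (X 0 ^ 3 + X 1 ^ 3 + X 2 ^ 3) ^ 2 - 12 * (X 0 ^ 3 * X 1 ^ 3 + X 0 ^ 3 * X 2 ^ 3 + X 1 ^ 3 * X 2 ^ 3) := by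
  ring

/-- **`Φ₆ = −3(x³ + y³ + z³)² + 4(x³ + εy³ + ε²z³)(x³ + ε²y³ + εz³)`** (`ω² + ω + 1 = 0`).
[cite: ArtebaniDolgachev2009, §6 (second display); §7, proof of Prop. 7.4
(`Φ₆ = −3F₁² + 4P₁P₁′`)] -/
theorem phi6_eq_B₁_mul_B₅ {ω : K} (hω : ω ^ 2 + ω + 1 = 0) :
    (Φ₆ : MvPolynomial (Fin 3) K) =
      -3 * (X 0 ^ 3 + X 1 ^ 3 + X 2 ^ 3) ^ 2 + 4 * (𝐁₁[ω] * 𝐁₅[ω]) := by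
  have hC : (C ω : MvPolynomial (Fin 3) K) ^ 2 + C ω + 1 = 0 := by
    rw [← C_pow, ← C_add, ← C_1, ← C_add, hω, C_0]
  simp only [map_pow]
  linear_combination (-4 * X 0 ^ 3 * X 1 ^ 3 - 4 * X 0 ^ 3 * X 2 ^ 3 - 4 * X 1 ^ 6 * C ω + 4 * X 1 ^ 6 -
    4 * X 1 ^ 3 * X 2 ^ 3 * C ω ^ 2 + 4 * X 1 ^ 3 * X 2 ^ 3 * C ω - 4 * X 1 ^ 3 * X 2 ^ 3 -
    4 * X 2 ^ 6 * C ω + 4 * X 2 ^ 6 : MvPolynomial (Fin 3) K) * hC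

/-- **"the points where `C₆` intersects the curve `E₀ : x³ + y³ + z³ = 0`" lie on `B₁ ∪ B₁′`**:
over a field with `2 ≠ 0` and `ω² + ω + 1 = 0`, if `x³ + y³ + z³ = 0` and `Φ₆ = 0` at `q`, then
`B₁(q)·B₁′(q) = 0`. [cite: ArtebaniDolgachev2009, §6 ("the curves `B₁` and `B₁′` are tangent to
`C₆` at the points where `C₆` intersects the curve `E₀`")] -/
theorem phi6_inter_fermat_subset (h2 : (2 : K) ≠ 0) {ω : K} (hω : ω ^ 2 + ω + 1 = 0)
    {q : Fin 3 → K} (ht : eval q (X 0 ^ 3 + X 1 ^ 3 + X 2 ^ 3 : MvPolynomial (Fin 3) K) = 0)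
    (h6 : eval q (Φ₆ : MvPolynomial (Fin 3) K) = 0) :
    eval q (𝐁₁[ω] : MvPolynomial (Fin 3) K) * eval q (𝐁₅[ω] : MvPolynomial (Fin 3) K) = 0 := by
  have h := congrArg (eval q) (phi6_eq_B₁_mul_B₅ (K := K) hω)
  rw [h6] at h
  simp only [map_add, map_mul, map_pow, map_neg, map_ofNat, eval_X, eval_C] at h ht ⊢
  have h4 : (4 : K) ≠ 0 := by
    rw [show (4 : K) = 2 * 2 by norm_num]
    exact mul_ne_zero h2 h2
  have key : (4 : K) * ((q 0 ^ 3 + ω * q 1 ^ 3 + ω ^ 2 * q 2 ^ 3) *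
      (q 0 ^ 3 + ω ^ 2 * q 1 ^ 3 + ω * q 2 ^ 3)) = 0 := by
    linear_combination (-1 : K) * h + 3 * (q 0 ^ 3 + q 1 ^ 3 + q 2 ^ 3) * ht
  exact (mul_eq_zero.1 key).resolve_left h4

/-- `∇B₁(p) = (3p₀², 3ωp₁², 3ω²p₂²)`. [folklore] -/
private theorem B₁_eval_pderiv' (ω : K) (p : Fin 3 → K) :
    (fun i => eval p (pderiv i (𝐁₁[ω] : MvPolynomial (Fin 3) K))) =
      ![3 * p 0 ^ 2, 3 * ω * p 1 ^ 2, 3 * ω ^ 2 * p 2 ^ 2] := by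
  funext i
  fin_cases i <;> simp [pderiv_X, map_ofNat] <;> ring

/-- **"`C₆` is tangent to … `B₁` … at the points where `C₆` intersects `E₀`"**: over a field with
`ω² + ω + 1 = 0`, at a point `q` with `x³ + y³ + z³ = 0` and `B₁(q) = 0` one has
`∇Φ₆(q) = 4B₁′(q)·∇B₁(q)` — the two curves have the same tangent line there (from
`Φ₆ = −3t² + 4B₁B₁′`: `∇Φ₆ = −6t∇t + 4(B₁′∇B₁ + B₁∇B₁′)`).
[cite: ArtebaniDolgachev2009, §6 ("Observe that the curve `C₆` is tangent to each Halphen cubic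
`Bᵢ, Bᵢ′` at a `Γ`-orbit of `9` points")] -/
theorem phi6_grad_of_mem {ω : K} (hω : ω ^ 2 + ω + 1 = 0) {q : Fin 3 → K}
    (ht : eval q (X 0 ^ 3 + X 1 ^ 3 + X 2 ^ 3 : MvPolynomial (Fin 3) K) = 0)
    (hB : eval q (𝐁₁[ω] : MvPolynomial (Fin 3) K) = 0) :
    (fun i => eval q (pderiv i (Φ₆ : MvPolynomial (Fin 3) K))) =
      (4 * eval q (𝐁₅[ω] : MvPolynomial (Fin 3) K)) • (fun i => eval q (pderiv i (𝐁₁[ω] : MvPolynomial (Fin 3) K))) := by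
  rw [phi6_eval_pderiv, B₁_eval_pderiv']
  simp only [map_add, map_mul, map_pow, eval_X, eval_C] at ht hB ⊢
  -- `B₁′(q) = 3q₀³`, `ωB₁′(q) = 3q₁³`, `ω²B₁′(q) = 3q₂³`
  have h5 : q 0 ^ 3 + ω ^ 2 * q 1 ^ 3 + ω * q 2 ^ 3 = 3 * q 0 ^ 3 := by
    linear_combination (-1 : K) * ht - hB + (q 1 ^ 3 + q 2 ^ 3) * hω
  have h5' : ω * (q 0 ^ 3 + ω ^ 2 * q 1 ^ 3 + ω * q 2 ^ 3) = 3 * q 1 ^ 3 := by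
    linear_combination (-1 : K) * ht - ω ^ 2 * hB +
      (q 0 ^ 3 + 2 * (ω - 1) * q 1 ^ 3 + (ω ^ 2 - ω + 1) * q 2 ^ 3) * hω
  have h5'' : ω ^ 2 * (q 0 ^ 3 + ω ^ 2 * q 1 ^ 3 + ω * q 2 ^ 3) = 3 * q 2 ^ 3 := by
    linear_combination (-1 : K) * ht - ω * hB +
      (q 0 ^ 3 + (ω ^ 2 - ω + 1) * q 1 ^ 3 + 2 * (ω - 1) * q 2 ^ 3) * hω
  simp only [Matrix.smul_cons, Matrix.smul_empty, smul_eq_mul, vec3_eq_iff']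
  exact ⟨by linear_combination (-30 * q 0 ^ 2) * ht - 12 * q 0 ^ 2 * h5,
    by linear_combination (-30 * q 1 ^ 2) * ht - 12 * q 1 ^ 2 * h5',
    by linear_combination (-30 * q 2 ^ 2) * ht - 12 * q 2 ^ 2 * h5''⟩

/-! ## §2 The syzygy of `xyz`, `x³ + y³ + z³`, `Φ₆`, `Φ₉` (Remark 6.2, van Geemen) -/

/-- **The relation among the invariants `s = xyz`, `t = x³ + y³ + z³`, `Φ₆`, `Φ₉`** (any field):
`432·Φ₉² = Φ₆³ − 3t⁴Φ₆ + 2t⁶ − 1080t³s³ − 648ts³Φ₆ − 11664s⁶` — `Φ₉²` is the discriminant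
`σ₁²σ₂² − 4σ₂³ − 4σ₁³σ₃ + 18σ₁σ₂σ₃ − 27σ₃²` of the cubic with roots `x³, y³, z³`
(`σ₁ = t`, `σ₂ = (t² − Φ₆)/12`, `σ₃ = s³`); constants pinned here, the source printing the
relation "up to some constant factors". [cite: ArtebaniDolgachev2009, §6, Remark 6.2 (the
polynomials `xyz, x³ + y³ + z³, Φ₆, Φ₉` satisfy the relation (relation))] -/
theorem hessian_invariants_syzygy :
    (432 : MvPolynomial (Fin 3) K) * Φ₉ ^ 2 =
      Φ₆ ^ 3 - 3 * (X 0 ^ 3 + X 1 ^ 3 + X 2 ^ 3) ^ 4 * Φ₆ + 2 * (X 0 ^ 3 + X 1 ^ 3 + X 2 ^ 3) ^ 6 -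
        1080 * (X 0 ^ 3 + X 1 ^ 3 + X 2 ^ 3) ^ 3 * (X 0 * X 1 * X 2) ^ 3 -
        648 * (X 0 ^ 3 + X 1 ^ 3 + X 2 ^ 3) * (X 0 * X 1 * X 2) ^ 3 * Φ₆ -
        11664 * (X 0 * X 1 * X 2) ^ 6 := by
  ring

/-- **Remark 6.2 / [vG]: "the polynomials `xyz, x³ + y³ + z³, Φ₆(x, y, z)`, and `Φ₉(x, y, z)`
satisfy the same relation `−u₃² + u₂³ + A(u₀, u₁)u₂ + B(u₀, u₁) = 0` … up to some constant
factors"** — with the constants made explicit: for `u₀ = −6xyz`, `u₁ = x³ + y³ + z³`, `u₂ = −2Φ₆`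
and `A(u₀,u₁) = 12u₁(u₀³ − u₁³)`, `B(u₀,u₁) = 2(u₀⁶ − 20u₀³u₁³ − 8u₁⁶)` (the binary forms of §2,
`HessePencilShortWeierstrassForm`): `u₂³ + A·u₂ + B = −3456·Φ₉²` (so `u₃ = 24√−6·Φ₉`; any field).
[cite: ArtebaniDolgachev2009, §6, Remark 6.2 (eq. (relation) in `ℙ(1,1,2,3)`)] -/
theorem hessian_invariants_syzygy_weighted :
    ((-2 : MvPolynomial (Fin 3) K) * Φ₆) ^ 3 +
        (12 * (X 0 ^ 3 + X 1 ^ 3 + X 2 ^ 3) *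
          ((-6 * (X 0 * X 1 * X 2)) ^ 3 - (X 0 ^ 3 + X 1 ^ 3 + X 2 ^ 3) ^ 3)) * ((-2 : MvPolynomial (Fin 3) K) * Φ₆) +
        2 * ((-6 * (X 0 * X 1 * X 2)) ^ 6 - 20 * (-6 * (X 0 * X 1 * X 2)) ^ 3 *
          (X 0 ^ 3 + X 1 ^ 3 + X 2 ^ 3) ^ 3 - 8 * (X 0 ^ 3 + X 1 ^ 3 + X 2 ^ 3) ^ 6) =
      -3456 * Φ₉ ^ 2 := by
  ring

/-! ## §3 Proposition 6.1: the double points of `Φ₆′` at `p₁, …, p₈` -/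

/-- **"the sextic has cusps at `p₁, …, p₈`" — `Φ₆′` vanishes with multiplicity `≥ 2` at the eight
base points `p₁ = (0,1,−ε), p₂ = (0,1,−ε²), p₃ = (1,0,−1), p₄ = (1,0,−ε²), p₅ = (1,0,−ε),
p₆ = (1,−1,0), p₇ = (1,−ε,0), p₈ = (1,−ε²,0)`**: `Φ₆′(pᵢ) = 0` and `∇Φ₆′(pᵢ) = 0`
(`ω² + ω + 1 = 0`). [cite: ArtebaniDolgachev2009, §6, Prop. 6.1 (proof: "`V` … polynomials of
degree `6` vanishing at `p₁, …, p₈` with multiplicity `≥ 2`")] -/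
theorem phi6'_double_points {ω : K} (hω : ω ^ 2 + ω + 1 = 0) :
    ∀ q ∈ [![(0 : K), 1, -ω], ![(0 : K), 1, -ω ^ 2], ![(1 : K), 0, -1], ![(1 : K), 0, -ω ^ 2],
      ![(1 : K), 0, -ω], ![(1 : K), -1, 0], ![(1 : K), -ω, 0], ![(1 : K), -ω ^ 2, 0]],
      eval q (Φ₆' : MvPolynomial (Fin 3) K) = 0 ∧ (fun i => eval q (pderiv i (Φ₆' : MvPolynomial (Fin 3) K))) = 0 := by
  intro q hq
  simp only [List.mem_cons, List.not_mem_nil, or_false] at hq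
  rcases hq with rfl | rfl | rfl | rfl | rfl | rfl | rfl | rfl
  · refine ⟨?_, ?_⟩
    · rw [phi6'_eval]
      simp only [Matrix.cons_val_zero, Matrix.cons_val_one, Matrix.cons_val_two, Matrix.head_cons,
        Matrix.tail_cons]
      linear_combination (ω ^ 4 + 11 * ω ^ 3 + 12 * ω ^ 2 + 11 * ω + 1) * hω
    · rw [phi6'_eval_pderiv]
      simp only [Matrix.cons_val_zero, Matrix.cons_val_one, Matrix.cons_val_two, Matrix.head_cons,
        Matrix.tail_cons, vec3_eq_zero_iff]
      exact ⟨by ring, by linear_combination (12 * ω ^ 3 + 36 * ω ^ 2 + 54 * ω + 6) * hω, by linear_combination (-6 * ω ^ 3 - 54 * ω ^ 2 - 36 * ω - 12) * hω⟩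
  · refine ⟨?_, ?_⟩
    · rw [phi6'_eval]
      simp only [Matrix.cons_val_zero, Matrix.cons_val_one, Matrix.cons_val_two, Matrix.head_cons,
        Matrix.tail_cons]
      linear_combination (ω ^ 10 - (ω ^ 9) + 12 * ω ^ 8 - 11 * ω ^ 7 + 23 * ω ^ 6 - 12 * ω ^ 5 + 23 * ω ^ 4 - 11 * ω ^ 3 + 12 * ω ^ 2 - (ω) + 1) * hω
    · rw [phi6'_eval_pderiv]
      simp only [Matrix.cons_val_zero, Matrix.cons_val_one, Matrix.cons_val_two, Matrix.head_cons,
        Matrix.tail_cons, vec3_eq_zero_iff]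
      exact ⟨by ring, by linear_combination (12 * ω ^ 8 - 12 * ω ^ 7 + 48 * ω ^ 6 - 36 * ω ^ 5 + 90 * ω ^ 4 - 54 * ω ^ 3 + 60 * ω ^ 2 - 6 * ω + 6) * hω, by linear_combination (-6 * ω ^ 8 + 6 * ω ^ 7 - 60 * ω ^ 6 + 54 * ω ^ 5 - 90 * ω ^ 4 + 36 * ω ^ 3 - 48 * ω ^ 2 + 12 * ω - 12) * hω⟩
  · refine ⟨?_, ?_⟩
    · rw [phi6'_eval]
      simp only [Matrix.cons_val_zero, Matrix.cons_val_one, Matrix.cons_val_two, Matrix.head_cons,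
        Matrix.tail_cons]
      ring
    · rw [phi6'_eval_pderiv]
      simp only [Matrix.cons_val_zero, Matrix.cons_val_one, Matrix.cons_val_two, Matrix.head_cons,
        Matrix.tail_cons, vec3_eq_zero_iff]
      exact ⟨by ring, by ring, by ring⟩
  · refine ⟨?_, ?_⟩
    · rw [phi6'_eval]
      simp only [Matrix.cons_val_zero, Matrix.cons_val_one, Matrix.cons_val_two, Matrix.head_cons,
        Matrix.tail_cons]
      linear_combination (ω ^ 10 - (ω ^ 9) + ω ^ 7 - (ω ^ 6) - (ω ^ 4) + ω ^ 3 - (ω) + 1) * hω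
    · rw [phi6'_eval_pderiv]
      simp only [Matrix.cons_val_zero, Matrix.cons_val_one, Matrix.cons_val_two, Matrix.head_cons,
        Matrix.tail_cons, vec3_eq_zero_iff]
      exact ⟨by linear_combination (-6 * ω ^ 4 + 6 * ω ^ 3 - 6 * ω + 6) * hω, by linear_combination (12 * ω ^ 8 - 12 * ω ^ 7 + 12 * ω ^ 5 - 12 * ω ^ 4) * hω, by linear_combination (-6 * ω ^ 8 + 6 * ω ^ 7 - 6 * ω ^ 5 + 6 * ω ^ 4) * hω⟩
  · refine ⟨?_, ?_⟩
    · rw [phi6'_eval]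
      simp only [Matrix.cons_val_zero, Matrix.cons_val_one, Matrix.cons_val_two, Matrix.head_cons,
        Matrix.tail_cons]
      linear_combination (ω ^ 4 - (ω ^ 3) - (ω) + 1) * hω
    · rw [phi6'_eval_pderiv]
      simp only [Matrix.cons_val_zero, Matrix.cons_val_one, Matrix.cons_val_two, Matrix.head_cons,
        Matrix.tail_cons, vec3_eq_zero_iff]
      exact ⟨by linear_combination (-6 * ω + 6) * hω, by linear_combination (12 * ω ^ 3 - 12 * ω ^ 2) * hω, by linear_combination (-6 * ω ^ 3 + 6 * ω ^ 2) * hω⟩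
  · refine ⟨?_, ?_⟩
    · rw [phi6'_eval]
      simp only [Matrix.cons_val_zero, Matrix.cons_val_one, Matrix.cons_val_two, Matrix.head_cons,
        Matrix.tail_cons]
      ring
    · rw [phi6'_eval_pderiv]
      simp only [Matrix.cons_val_zero, Matrix.cons_val_one, Matrix.cons_val_two, Matrix.head_cons,
        Matrix.tail_cons, vec3_eq_zero_iff]
      exact ⟨by ring, by ring, by ring⟩
  · refine ⟨?_, ?_⟩
    · rw [phi6'_eval]
      simp only [Matrix.cons_val_zero, Matrix.cons_val_one, Matrix.cons_val_two, Matrix.head_cons,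
        Matrix.tail_cons]
      linear_combination (ω ^ 4 - (ω ^ 3) - (ω) + 1) * hω
    · rw [phi6'_eval_pderiv]
      simp only [Matrix.cons_val_zero, Matrix.cons_val_one, Matrix.cons_val_two, Matrix.head_cons,
        Matrix.tail_cons, vec3_eq_zero_iff]
      exact ⟨by linear_combination (-6 * ω + 6) * hω, by linear_combination (-6 * ω ^ 3 + 6 * ω ^ 2) * hω, by linear_combination (12 * ω ^ 3 - 12 * ω ^ 2) * hω⟩
  · refine ⟨?_, ?_⟩
    · rw [phi6'_eval]
      simp only [Matrix.cons_val_zero, Matrix.cons_val_one, Matrix.cons_val_two, Matrix.head_cons,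
        Matrix.tail_cons]
      linear_combination (ω ^ 10 - (ω ^ 9) + ω ^ 7 - (ω ^ 6) - (ω ^ 4) + ω ^ 3 - (ω) + 1) * hω
    · rw [phi6'_eval_pderiv]
      simp only [Matrix.cons_val_zero, Matrix.cons_val_one, Matrix.cons_val_two, Matrix.head_cons,
        Matrix.tail_cons, vec3_eq_zero_iff]
      exact ⟨by linear_combination (-6 * ω ^ 4 + 6 * ω ^ 3 - 6 * ω + 6) * hω, by linear_combination (-6 * ω ^ 8 + 6 * ω ^ 7 - 6 * ω ^ 5 + 6 * ω ^ 4) * hω, by linear_combination (12 * ω ^ 8 - 12 * ω ^ 7 + 12 * ω ^ 5 - 12 * ω ^ 4) * hω⟩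

/-- **`p₀ = (0, 1, −1)` is NOT a double point**: `Φ₆′(p₀) = 108` and `∇Φ₆′(p₀) = (0, 324, −324)`
(so `p₀ ∉ C₆′` whenever `2, 3 ≠ 0`; the cusps are exactly at the images `q₁, …, q₈` of the eight
non-zero `3`-torsion sections). [cite: ArtebaniDolgachev2009, §6 ("a curve of degree `6` with cusps
at the points `q₁, …, q₈`")] -/
theorem phi6'_eval_p₀ :
    eval ![(0 : K), 1, -1] (Φ₆' : MvPolynomial (Fin 3) K) = 108 ∧
      (fun i => eval ![(0 : K), 1, -1] (pderiv i (Φ₆' : MvPolynomial (Fin 3) K))) = ![0, 324, -324] := by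
  refine ⟨?_, ?_⟩
  · rw [phi6'_eval]
    simp only [Matrix.cons_val_zero, Matrix.cons_val_one, Matrix.cons_val_two, Matrix.head_cons,
      Matrix.tail_cons]
    norm_num
  · rw [phi6'_eval_pderiv]
    simp only [Matrix.cons_val_zero, Matrix.cons_val_one, Matrix.cons_val_two, Matrix.head_cons,
      Matrix.tail_cons, vec3_eq_iff']
    norm_num

/-! ## §4 `C₆` avoids the `21` special points; `C₆` is smooth -/

/-- **"it does not contain the vertices of the inflection triangles … as well as the base points
of the Hesse pencil"**: `Φ₆ = 1` at the vertices `(1,0,0), (0,1,0), (0,0,1)` of `XYZ`.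
[cite: ArtebaniDolgachev2009, §6 (first paragraph)] -/
theorem phi6_eval_coordinate_vertices :
    ∀ q ∈ [![(1 : K), 0, 0], ![(0 : K), 1, 0], ![(0 : K), 0, 1]], eval q (Φ₆ : MvPolynomial (Fin 3) K) = 1 := by
  intro q hq
  simp only [List.mem_cons, List.not_mem_nil, or_false] at hq
  rcases hq with rfl | rfl | rfl
  · rw [phi6_eval]
    simp only [Matrix.cons_val_zero, Matrix.cons_val_one, Matrix.cons_val_two, Matrix.head_cons,
        Matrix.tail_cons]
    ring
  · rw [phi6_eval]
    simp only [Matrix.cons_val_zero, Matrix.cons_val_one, Matrix.cons_val_two, Matrix.head_cons,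
        Matrix.tail_cons]
    ring
  · rw [phi6_eval]
    simp only [Matrix.cons_val_zero, Matrix.cons_val_one, Matrix.cons_val_two, Matrix.head_cons,
        Matrix.tail_cons]
    ring

/-- `Φ₆ = −27` at the nine vertices `(1,1,1), (1,ε,ε²), (1,ε²,ε), (ε²,1,1), (1,ε²,1), (1,1,ε²),
(ε,1,1), (1,ε,1), (1,1,ε)` of the triangles `E_{−3}, E_{−3ε}, E_{−3ε²}` (`ω² + ω + 1 = 0`; non-zero
iff `3 ≠ 0`). [cite: ArtebaniDolgachev2009, §6 (first paragraph)] -/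
theorem phi6_eval_vertices {ω : K} (hω : ω ^ 2 + ω + 1 = 0) :
    ∀ q ∈ [![(1 : K), 1, 1], ![(1 : K), ω, ω ^ 2], ![(1 : K), ω ^ 2, ω], ![ω ^ 2, (1 : K), 1], ![(1 : K), ω ^ 2, 1], ![(1 : K), 1, ω ^ 2], ![ω, (1 : K), 1], ![(1 : K), ω, 1], ![(1 : K), 1, ω]], eval q (Φ₆ : MvPolynomial (Fin 3) K) = -27 := by
  intro q hq
  simp only [List.mem_cons, List.not_mem_nil, or_false] at hq
  rcases hq with rfl | rfl | rfl | rfl | rfl | rfl | rfl | rfl | rfl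
  · rw [phi6_eval]
    simp only [Matrix.cons_val_zero, Matrix.cons_val_one, Matrix.cons_val_two, Matrix.head_cons,
        Matrix.tail_cons]
    ring
  · rw [phi6_eval]
    simp only [Matrix.cons_val_zero, Matrix.cons_val_one, Matrix.cons_val_two, Matrix.head_cons,
        Matrix.tail_cons]
    linear_combination (ω ^ 10 - (ω ^ 9) - 9 * ω ^ 7 + 9 * ω ^ 6 - 18 * ω ^ 4 + 18 * ω ^ 3 - 28 * ω + 28) * hω
  · rw [phi6_eval]
    simp only [Matrix.cons_val_zero, Matrix.cons_val_one, Matrix.cons_val_two, Matrix.head_cons,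
        Matrix.tail_cons]
    linear_combination (ω ^ 10 - (ω ^ 9) - 9 * ω ^ 7 + 9 * ω ^ 6 - 18 * ω ^ 4 + 18 * ω ^ 3 - 28 * ω + 28) * hω
  · rw [phi6_eval]
    simp only [Matrix.cons_val_zero, Matrix.cons_val_one, Matrix.cons_val_two, Matrix.head_cons,
        Matrix.tail_cons]
    linear_combination (ω ^ 10 - (ω ^ 9) + ω ^ 7 - (ω ^ 6) - 19 * ω ^ 4 + 19 * ω ^ 3 - 19 * ω + 19) * hω
  · rw [phi6_eval]
    simp only [Matrix.cons_val_zero, Matrix.cons_val_one, Matrix.cons_val_two, Matrix.head_cons,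
        Matrix.tail_cons]
    linear_combination (ω ^ 10 - (ω ^ 9) + ω ^ 7 - (ω ^ 6) - 19 * ω ^ 4 + 19 * ω ^ 3 - 19 * ω + 19) * hω
  · rw [phi6_eval]
    simp only [Matrix.cons_val_zero, Matrix.cons_val_one, Matrix.cons_val_two, Matrix.head_cons,
        Matrix.tail_cons]
    linear_combination (ω ^ 10 - (ω ^ 9) + ω ^ 7 - (ω ^ 6) - 19 * ω ^ 4 + 19 * ω ^ 3 - 19 * ω + 19) * hω
  · rw [phi6_eval]
    simp only [Matrix.cons_val_zero, Matrix.cons_val_one, Matrix.cons_val_two, Matrix.head_cons,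
        Matrix.tail_cons]
    linear_combination (ω ^ 4 - (ω ^ 3) - 19 * ω + 19) * hω
  · rw [phi6_eval]
    simp only [Matrix.cons_val_zero, Matrix.cons_val_one, Matrix.cons_val_two, Matrix.head_cons,
        Matrix.tail_cons]
    linear_combination (ω ^ 4 - (ω ^ 3) - 19 * ω + 19) * hω
  · rw [phi6_eval]
    simp only [Matrix.cons_val_zero, Matrix.cons_val_one, Matrix.cons_val_two, Matrix.head_cons,
        Matrix.tail_cons]
    linear_combination (ω ^ 4 - (ω ^ 3) - 19 * ω + 19) * hω

/-- `Φ₆ = 12` at the nine base points `p₀, …, p₈` (`ω² + ω + 1 = 0`; non-zero iff `2, 3 ≠ 0`).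
[cite: ArtebaniDolgachev2009, §6 (first paragraph)] -/
theorem phi6_eval_basePoints {ω : K} (hω : ω ^ 2 + ω + 1 = 0) :
    ∀ q ∈ [![(0 : K), 1, -1], ![(0 : K), 1, -ω], ![(0 : K), 1, -ω ^ 2], ![(1 : K), 0, -1], ![(1 : K), 0, -ω ^ 2], ![(1 : K), 0, -ω], ![(1 : K), -1, 0], ![(1 : K), -ω, 0], ![(1 : K), -ω ^ 2, 0]], eval q (Φ₆ : MvPolynomial (Fin 3) K) = 12 := by
  intro q hq
  simp only [List.mem_cons, List.not_mem_nil, or_false] at hq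
  rcases hq with rfl | rfl | rfl | rfl | rfl | rfl | rfl | rfl | rfl
  · rw [phi6_eval]
    simp only [Matrix.cons_val_zero, Matrix.cons_val_one, Matrix.cons_val_two, Matrix.head_cons,
        Matrix.tail_cons]
    ring
  · rw [phi6_eval]
    simp only [Matrix.cons_val_zero, Matrix.cons_val_one, Matrix.cons_val_two, Matrix.head_cons,
        Matrix.tail_cons]
    linear_combination (ω ^ 4 - (ω ^ 3) + 11 * ω - 11) * hω
  · rw [phi6_eval]
    simp only [Matrix.cons_val_zero, Matrix.cons_val_one, Matrix.cons_val_two, Matrix.head_cons,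
        Matrix.tail_cons]
    linear_combination (ω ^ 10 - (ω ^ 9) + ω ^ 7 - (ω ^ 6) + 11 * ω ^ 4 - 11 * ω ^ 3 + 11 * ω - 11) * hω
  · rw [phi6_eval]
    simp only [Matrix.cons_val_zero, Matrix.cons_val_one, Matrix.cons_val_two, Matrix.head_cons,
        Matrix.tail_cons]
    ring
  · rw [phi6_eval]
    simp only [Matrix.cons_val_zero, Matrix.cons_val_one, Matrix.cons_val_two, Matrix.head_cons,
        Matrix.tail_cons]
    linear_combination (ω ^ 10 - (ω ^ 9) + ω ^ 7 - (ω ^ 6) + 11 * ω ^ 4 - 11 * ω ^ 3 + 11 * ω - 11) * hω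
  · rw [phi6_eval]
    simp only [Matrix.cons_val_zero, Matrix.cons_val_one, Matrix.cons_val_two, Matrix.head_cons,
        Matrix.tail_cons]
    linear_combination (ω ^ 4 - (ω ^ 3) + 11 * ω - 11) * hω
  · rw [phi6_eval]
    simp only [Matrix.cons_val_zero, Matrix.cons_val_one, Matrix.cons_val_two, Matrix.head_cons,
        Matrix.tail_cons]
    ring
  · rw [phi6_eval]
    simp only [Matrix.cons_val_zero, Matrix.cons_val_one, Matrix.cons_val_two, Matrix.head_cons,
        Matrix.tail_cons]
    linear_combination (ω ^ 4 - (ω ^ 3) + 11 * ω - 11) * hω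
  · rw [phi6_eval]
    simp only [Matrix.cons_val_zero, Matrix.cons_val_one, Matrix.cons_val_two, Matrix.head_cons,
        Matrix.tail_cons]
    linear_combination (ω ^ 10 - (ω ^ 9) + ω ^ 7 - (ω ^ 6) + 11 * ω ^ 4 - 11 * ω ^ 3 + 11 * ω - 11) * hω

/-- **"This is a smooth curve"**: over a field with `2 ≠ 0` and `3 ≠ 0`, a point `p` with
`Φ₆(p) = 0` and `∇Φ₆(p) = 0` is `p = 0` (`∇Φ₆ = 6(x²(x³ − 5y³ − 5z³), …)`; the four cases of the
proof are the vanishing pattern of the coordinates). [cite: ArtebaniDolgachev2009, §6 ("Let `C₆`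
be the sextic curve with equation `Φ₆ = 0` … This is a smooth curve")] -/
theorem phi6_smooth (h2 : (2 : K) ≠ 0) (h3 : (3 : K) ≠ 0) {p : Fin 3 → K}
    (hp : eval p (Φ₆ : MvPolynomial (Fin 3) K) = 0) (hg : (fun i => eval p (pderiv i (Φ₆ : MvPolynomial (Fin 3) K))) = 0) :
    p = 0 := by
  rw [phi6_eval] at hp
  rw [phi6_eval_pderiv, vec3_eq_zero_iff] at hg
  obtain ⟨g0, g1, g2⟩ := hg
  have h6 : (6 : K) ≠ 0 := by
    rw [show (6 : K) = 2 * 3 by norm_num]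
    exact mul_ne_zero h2 h3
  have h24 : (24 : K) ≠ 0 := by
    rw [show (24 : K) = 2 * 2 * 2 * 3 by norm_num]
    exact mul_ne_zero (mul_ne_zero (mul_ne_zero h2 h2) h2) h3
  have h54 : (54 : K) ≠ 0 := by
    rw [show (54 : K) = 2 * 3 * 3 * 3 by norm_num]
    exact mul_ne_zero (mul_ne_zero (mul_ne_zero h2 h3) h3) h3
  have f0 : p 0 ^ 2 * (p 0 ^ 3 - 5 * p 1 ^ 3 - 5 * p 2 ^ 3) = 0 := by
    have : (6 : K) * (p 0 ^ 2 * (p 0 ^ 3 - 5 * p 1 ^ 3 - 5 * p 2 ^ 3)) = 0 := by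
      linear_combination g0
    exact (mul_eq_zero.1 this).resolve_left h6
  have f1 : p 1 ^ 2 * (p 1 ^ 3 - 5 * p 0 ^ 3 - 5 * p 2 ^ 3) = 0 := by
    have : (6 : K) * (p 1 ^ 2 * (p 1 ^ 3 - 5 * p 0 ^ 3 - 5 * p 2 ^ 3)) = 0 := by
      linear_combination g1
    exact (mul_eq_zero.1 this).resolve_left h6
  have f2 : p 2 ^ 2 * (p 2 ^ 3 - 5 * p 0 ^ 3 - 5 * p 1 ^ 3) = 0 := by
    have : (6 : K) * (p 2 ^ 2 * (p 2 ^ 3 - 5 * p 0 ^ 3 - 5 * p 1 ^ 3)) = 0 := by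
      linear_combination g2
    exact (mul_eq_zero.1 this).resolve_left h6
  -- from the three equations: each non-zero coordinate gives a linear relation among the cubes
  have e0 : p 0 ≠ 0 → p 0 ^ 3 - 5 * p 1 ^ 3 - 5 * p 2 ^ 3 = 0 := fun h =>
    (mul_eq_zero.1 f0).resolve_left (pow_ne_zero _ h)
  have e1 : p 1 ≠ 0 → p 1 ^ 3 - 5 * p 0 ^ 3 - 5 * p 2 ^ 3 = 0 := fun h =>
    (mul_eq_zero.1 f1).resolve_left (pow_ne_zero _ h)
  have e2 : p 2 ≠ 0 → p 2 ^ 3 - 5 * p 0 ^ 3 - 5 * p 1 ^ 3 = 0 := fun h =>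
    (mul_eq_zero.1 f2).resolve_left (pow_ne_zero _ h)
  have cube : ∀ {a : K}, a ^ 3 = 0 → a = 0 := fun h => (pow_eq_zero_iff three_ne_zero).1 h
  by_cases hx : p 0 = 0 <;> by_cases hy : p 1 = 0 <;> by_cases hz : p 2 = 0
  · funext i
    fin_cases i
    · exact hx
    · exact hy
    · exact hz
  · -- only `z ≠ 0`: `Φ₆ = z⁶`
    have h' : p 2 ^ 6 = 0 := by rw [hx, hy] at hp; linear_combination hp
    exact absurd ((pow_eq_zero_iff (by norm_num)).1 h') hz
  · have h' : p 1 ^ 6 = 0 := by rw [hx, hz] at hp; linear_combination hp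
    exact absurd ((pow_eq_zero_iff (by norm_num)).1 h') hy
  · -- `x = 0`, `y, z ≠ 0`: `y³ = 5z³`, `z³ = 5y³`, so `24y³ = 0`
    have a := e1 hy
    have b := e2 hz
    rw [hx] at a b
    have : (24 : K) * p 1 ^ 3 = 0 := by linear_combination (-1 : K) * a - 5 * b
    exact absurd (cube ((mul_eq_zero.1 this).resolve_left h24)) hy
  · have h' : p 0 ^ 6 = 0 := by rw [hy, hz] at hp; linear_combination hp
    exact absurd ((pow_eq_zero_iff (by norm_num)).1 h') hx
  · have a := e0 hx
    have b := e2 hz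
    rw [hy] at a b
    have : (24 : K) * p 0 ^ 3 = 0 := by linear_combination (-1 : K) * a - 5 * b
    exact absurd (cube ((mul_eq_zero.1 this).resolve_left h24)) hx
  · have a := e0 hx
    have b := e1 hy
    rw [hz] at a b
    have : (24 : K) * p 0 ^ 3 = 0 := by linear_combination (-1 : K) * a - 5 * b
    exact absurd (cube ((mul_eq_zero.1 this).resolve_left h24)) hx
  · -- all non-zero: summing gives `9t = 0`, then `6x³ = 0`
    have a := e0 hx
    have b := e1 hy
    have c := e2 hz
    have : (54 : K) * p 0 ^ 3 = 0 := by linear_combination 4 * a - 5 * b - 5 * c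
    exact absurd (cube ((mul_eq_zero.1 this).resolve_left h54)) hx

end CuspidalSextic

end Literature.AlgebraicGeometry.PlaneCurves
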